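import Summits.NavierStokesRegularity.NavierStokesRegularity.Theorems.ScenarioCensusRotationOrderRows
import Summits.NavierStokesRegularity.NavierStokesRegularity.Theorems.ScenarioCensusScrewBlowdownOffAxis
import HarnessLib

/-!
# LINE «rotation-order» port, part 3/3: rigidity of the AXIS and of the SCALING CENTRE — `Row_ApaT` / `Row_AdsT` / `Row_Apa2T` PROVED;
# census KEYS `Row_A9ir` / `Row_A9nc` / `Row_A9sr` / `Row_A9pa` / `Row_AD9c` / `Row_A13sq` + `_excluded`

Re-homed for the scenario census (typer seat ns-census-typer-1 g7; the cells are MEMBERS OF RECORD «DECIDED IN KERNEL IN FILES» of rows A9 / A13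
since census v1.68 (lead g9; critic idea-crit-3 PASS + RE-STAMPs 18:37:11Z / 18:47:14Z / 18:52:59Z; ref ns-census-ref g8 PRE-CHECK ✓ §13.14 [1/6];
lit §21.20); this port makes them TREE-decided): VERBATIM PORT of ns-idea-2 LINE g11-2 «rotation-order» REV 3,
`pub/ideators/ns-idea-2/lines/rotation-order/line-rotation-order.lean` sha16 5b02128187347f27 (744 l., lean check rc 0, 0 sorry), split for the 400-line rule
into `ScenarioCensusRotationOrder` (§0–§2: the rotations, the rotation-order group `stabAngles` and its dichotomy, slice-level conjugation, the
infinitesimal generator) → `…RotationOrderRows` (§3–§5: rows `Row_AirT` / `Row_AiaT` / `Row_AncT` / `Row_AsrT` / `Row_AsqT` + `_holds`, readings) →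
`…RotationOrderAxis` (§6 / §6b: rigidity of the axis and of the scaling centre, `Row_ApaT` / `Row_AdsT` / `Row_Apa2T` + `_holds`; census KEYS).  Lean text
VERBATIM in namespace `…Theorems.ScenarioCensus.RotationOrder` (the line's `…Lines.RotationOrder` re-homed); port edits: `local notation "E3"` → `abbrev E3`,
`[folklore]` dropped from the docstrings of the eight parameterless row `def`s (gate relocation rule), thirteen one-line docstrings added, the line's
`set_option linter.unusedVariables false` dropped (one proof lambda binds the unused `θ₀` as `_`), lemmas that restate already-landed tree declarations taken BY NAME (gate lint `dedup.landed`): `rotZ_add_vec` = `ScrewBlowdown.rotZ_add_vec`, `rotZ_sub_vec` = `ScrewBlowdown.rotZ_sub_vec`; `rotZ_smul_vec` / `rotZ_zero_vec` restate tree lemmas of a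
module that cannot be imported here (`…Theorems.FrequencyRigidity.MovingAdjointBernoulli.*'`, theses cone) — not re-declared, the use sites (`equivariant_conj_axis_of_dss`,
`vRot_vRot_neg`) carry a local `have` with the line's one-line proof (proof-only diffs).

No census VALUE is moved here (rows A9 / A13 keep their values; the members become TREE-decided by name); NS regularity is NOT proved; (L′) is
untouched; no summit statement is proved by this file.
-/

-- the summit and its single problem share the name `NavierStokesRegularity` (D-0017 nested layout)
set_option linter.dupNamespace false

noncomputable section

open Set Function
open Literature.Analysis.FluidPDE
open Summit.NavierStokesRegularity.NavierStokesRegularity.Theorems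

namespace Summit.NavierStokesRegularity.NavierStokesRegularity.Theorems.ScenarioCensus.RotationOrder

/-! ## §6  Rigidity of the AXIS and of the SCALING CENTRE (REV 2)

Two symmetries of a slice with DIFFERENT fixed-point sets produce, through a commutator / a quotient, a
symmetry with NO fixed point — a non-trivial spatial period — and census A13 (tree
`ScenarioCensus.PeriodicGauge.periodic_typeI_liouville_genuine`) kills every Type-I ancient mild field with a
non-zero spatial period.  Two instances are typed and proved here:
* two DISTINCT PARALLEL symmetry axes with the same rotation angle `θ ∉ 2πℤ` (`Row_ApaT`): the quotient
  `ρ_{c,θ} ∘ ρ_{c',θ}⁻¹` is the translation by `(I − R_θ)(c − c') ≠ 0`;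
* a `λ`-DSS field (`λ > 0`, `λ ≠ 1`, scaling centre the origin — the census convention) whose slices are
  `θ`-equivariant about a vertical axis NOT through the scaling centre (`Row_AdsT`): conjugating the rotation by
  the dilation gives the `θ`-rotation about the parallel axis through `λ⁻¹ c ≠ c`, and `Row_ApaT` applies.
Readings: a surviving (non-trivial) candidate has AT MOST ONE vertical symmetry axis of any given angle, and if
it is discretely self-similar its scaling centre lies ON the symmetry axis — the census coordinates (axis,
centre) of blocks A and D are ALIGNED for every non-trivial candidate. [folklore] -/

/-- Rotation by `θ` about the VERTICAL axis through the point `c`. [folklore] -/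
def vRot (c : E3) (θ : ℝ) (x : E3) : E3 := c + rotZ θ (x - c)

-- `rotZ_add_vec`: the line restates the tree's `ScrewBlowdown.rotZ_add_vec`; taken BY NAME (gate lint dedup.landed).

/-- `R_θ (−a) = −R_θ a`. -/
theorem rotZ_neg_vec (θ : ℝ) (a : E3) : rotZ θ (-a) = -rotZ θ a := by
  ext i
  fin_cases i <;> simp [rotZ] <;> ring

-- `rotZ_sub_vec`: the line restates the tree's `ScrewBlowdown.rotZ_sub_vec`; taken BY NAME (gate lint dedup.landed).

-- `rotZ_smul_vec`: restates the tree's `FrequencyRigidity.MovingAdjointBernoulli.rotZ_smul_vec' (module not importable here: theses-cone, farm rc 75)`; not re-declared — its uses carry a local `have`.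

-- `rotZ_zero_vec`: restates the tree's `FrequencyRigidity.MovingAdjointBernoulli.rotZ_zero_vec' (idem)`; not re-declared — its uses carry a local `have`.

/-- The quotient of the `θ`-rotations about two parallel vertical axes is the translation by
`(I − R_θ)(c − c')`. [folklore] -/
theorem vRot_comp_inv (c c' : E3) (θ : ℝ) (x : E3) :
    vRot c θ (vRot c' (-θ) x) = x + ((c - c') - rotZ θ (c - c')) := by
  unfold vRot
  have h1 : rotZ θ (rotZ (-θ) (x - c')) = x - c' := rotZ_rotZ_neg θ (x - c')
  rw [show c' + rotZ (-θ) (x - c') - c = rotZ (-θ) (x - c') - (c - c') by abel, ScrewBlowdown.rotZ_sub_vec, h1]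
  abel

/-- `ρ_{c,θ} ∘ ρ_{c,−θ} = id`. [folklore] -/
theorem vRot_vRot_neg (c : E3) (θ : ℝ) (x : E3) : vRot c θ (vRot c (-θ) x) = x := by
  -- port: the line's `@[simp] rotZ_zero_vec` restates a tree lemma in a module not importable here (dedup.landed); local copy:
  have rotZ_zero_vec : rotZ θ (0 : E3) = 0 := by ext i; fin_cases i <;> simp [rotZ]
  rw [vRot_comp_inv]; simp [rotZ_zero_vec]

/-- `(I − R_θ) v ≠ 0` when `cos θ ≠ 1` and `v` has a non-zero horizontal part. [folklore] -/
theorem sub_rotZ_ne_zero {θ : ℝ} {v : E3} (hθ : Real.cos θ ≠ 1) (hv : v 0 ≠ 0 ∨ v 1 ≠ 0) :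
    v - rotZ θ v ≠ 0 := by
  intro h
  have h0 := congrArg (fun z : E3 => z 0) h
  have h1 := congrArg (fun z : E3 => z 1) h
  simp only [PiLp.sub_apply, rotZ_apply_zero, rotZ_apply_one, PiLp.zero_apply] at h0 h1
  have key : (1 - Real.cos θ) * (v 0 ^ 2 + v 1 ^ 2) = 0 := by
    linear_combination (v 0) * h0 + (v 1) * h1
  have hc : (1 - Real.cos θ) ≠ 0 := sub_ne_zero.2 (Ne.symm hθ)
  have hsq : v 0 ^ 2 + v 1 ^ 2 = 0 := by
    rcases mul_eq_zero.1 key with h | h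
    · exact absurd h hc
    · exact h
  have ha : v 0 = 0 := by nlinarith [sq_nonneg (v 0), sq_nonneg (v 1)]
  have hb : v 1 = 0 := by nlinarith [sq_nonneg (v 0), sq_nonneg (v 1)]
  rcases hv with hv | hv
  · exact hv ha
  · exact hv hb

/-- `cos θ ≠ 1` unless `θ ∈ 2πℤ`. -/
theorem cos_ne_one_of_not_int_mul {θ : ℝ} (hθ : ∀ n : ℤ, θ ≠ n * (2 * Real.pi)) : Real.cos θ ≠ 1 := by
  intro h
  obtain ⟨n, hn⟩ := (Real.cos_eq_one_iff θ).1 h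
  exact hθ n hn.symm

/-- **Row A-pa-T** (two PARALLEL axes): a Type-I ancient mild field whose slices are `θ`-equivariant
(`θ ∉ 2πℤ`) about two DISTINCT parallel vertical axes (through `c` and `c'`) vanishes on the past — the
quotient of the two rotations is the spatial period `(I − R_θ)(c − c') ≠ 0` (census A13). -/
def Row_ApaT : Prop :=
  ∀ (C : ℝ) (u : ℝ → E3 → E3) (c c' : E3) (θ : ℝ), IsTypeIAncientMild C u →
    (∀ n : ℤ, θ ≠ n * (2 * Real.pi)) → (c 0 ≠ c' 0 ∨ c 1 ≠ c' 1) →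
    (∀ t < 0, ∀ x, u t (c + rotZ θ (x - c)) = rotZ θ (u t x)) →
    (∀ t < 0, ∀ x, u t (c' + rotZ θ (x - c')) = rotZ θ (u t x)) →
    ∀ t < 0, ∀ x, u t x = 0

/-- **Row A-ds-T** (DSS centre OFF the symmetry axis): a Type-I ancient mild field which is `λ`-DSS about
the origin (`0 < λ ≠ 1`, Literature `IsDiscretelySelfSimilar`) and whose slices are `θ`-equivariant
(`θ ∉ 2πℤ`) about a vertical axis NOT through the origin vanishes on the past. -/
def Row_AdsT : Prop :=
  ∀ (C : ℝ) (u : ℝ → E3 → E3) (c : E3) (θ lam : ℝ), IsTypeIAncientMild C u → 0 < lam → lam ≠ 1 →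
    IsDiscretelySelfSimilar lam u → (∀ n : ℤ, θ ≠ n * (2 * Real.pi)) → (c 0 ≠ 0 ∨ c 1 ≠ 0) →
    (∀ t < 0, ∀ x, u t (c + rotZ θ (x - c)) = rotZ θ (u t x)) →
    ∀ t < 0, ∀ x, u t x = 0

/-- **ROW A-pa-T holds.** -/
theorem row_ApaT_holds : Row_ApaT := by
  intro C u c c' θ hu hθ hcc hf hg
  -- inverse equivariance about the second axis
  have hginv : ∀ t < 0, ∀ x, u t (vRot c' (-θ) x) = rotZ (-θ) (u t x) := by
    intro t ht x
    have h1 := hg t ht (vRot c' (-θ) x)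
    change u t (vRot c' θ (vRot c' (-θ) x)) = _ at h1
    rw [vRot_vRot_neg] at h1
    rw [h1, rotZ_neg_rotZ]
  -- the quotient is a non-zero spatial period
  set w : E3 := (c - c') - rotZ θ (c - c') with hw_def
  have hper : ∀ t < 0, ∀ x, u t (x + w) = u t x := by
    intro t ht x
    have h1 : x + w = vRot c θ (vRot c' (-θ) x) := (vRot_comp_inv c c' θ x).symm
    rw [h1]
    change u t (c + rotZ θ (vRot c' (-θ) x - c)) = u t x
    rw [hf t ht, hginv t ht, rotZ_rotZ_neg]
  have hw : w ≠ 0 := by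
    apply sub_rotZ_ne_zero (cos_ne_one_of_not_int_mul hθ)
    rcases hcc with h | h
    · left; simpa [sub_eq_zero] using h
    · right; simpa [sub_eq_zero] using h
  exact ScenarioCensus.PeriodicGauge.periodic_typeI_liouville_genuine C u hu w hw hper

/-- Conjugating a rotational symmetry by the discrete scaling: a `λ`-DSS field whose slices are
`θ`-equivariant about the vertical axis through `c` has slices `θ`-equivariant about the parallel axis
through `λ⁻¹ c`. [folklore] -/
theorem equivariant_conj_axis_of_dss {u : ℝ → E3 → E3} {c : E3} {θ lam : ℝ} (hl : 0 < lam)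
    (hd : IsDiscretelySelfSimilar lam u)
    (hf : ∀ t < 0, ∀ x, u t (c + rotZ θ (x - c)) = rotZ θ (u t x)) :
    ∀ t < 0, ∀ x, u t (lam⁻¹ • c + rotZ θ (x - lam⁻¹ • c)) = rotZ θ (u t x) := by
  -- port: the line's helper `rotZ_smul_vec` restates a tree lemma in a module not importable here (dedup.landed); local copy:
  have rotZ_smul_vec : ∀ (θ₁ r : ℝ) (a : E3), rotZ θ₁ (r • a) = r • rotZ θ₁ a := fun θ₁ r a => by
    ext i; fin_cases i <;> simp [rotZ] <;> ring
  intro t ht x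
  have hl0 : lam ≠ 0 := hl.ne'
  have hdss : ∀ s y, lam • u (lam ^ 2 * s) (lam • y) = u s y := fun s y => by
    have := congrFun (congrFun hd s) y
    simpa [nsRescale] using this
  have ht' : lam ^ 2 * t < 0 := mul_neg_of_pos_of_neg (by positivity) ht
  have key : lam • (lam⁻¹ • c + rotZ θ (x - lam⁻¹ • c)) = c + rotZ θ (lam • x - c) := by
    rw [smul_add, smul_smul, mul_inv_cancel₀ hl0, one_smul, ← rotZ_smul_vec, smul_sub, smul_smul,
      mul_inv_cancel₀ hl0, one_smul]
  rw [← hdss t (lam⁻¹ • c + rotZ θ (x - lam⁻¹ • c)), key, hf _ ht' (lam • x), ← rotZ_smul_vec, hdss]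

/-- **ROW A-ds-T holds** (via `Row_ApaT`: the axes through `c` and `λ⁻¹ c` are distinct and parallel). -/
theorem row_AdsT_holds : Row_AdsT := by
  intro C u c θ lam hu hl hl1 hd hθ hc hf
  have hf' := equivariant_conj_axis_of_dss hl hd hf
  have hne : c 0 ≠ (lam⁻¹ • c) 0 ∨ c 1 ≠ (lam⁻¹ • c) 1 := by
    have hl0 : lam ≠ 0 := hl.ne'
    have hli : lam⁻¹ ≠ 1 := fun h => hl1 (inv_eq_one.1 h)
    have aux : ∀ a : ℝ, a ≠ 0 → a ≠ lam⁻¹ * a := fun a ha h => by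
      have : (1 - lam⁻¹) * a = 0 := by linear_combination h
      rcases mul_eq_zero.1 this with h2 | h2
      · exact hli (by linarith)
      · exact ha h2
    rcases hc with h | h
    · left; simpa [PiLp.smul_apply] using aux _ h
    · right; simpa [PiLp.smul_apply] using aux _ h
  exact row_ApaT_holds C u c (lam⁻¹ • c) θ hu hθ hne hf hf'

/-- Reading (axis uniqueness): a NON-TRIVIAL Type-I ancient mild field has at most one vertical axis of
`θ`-symmetry for each `θ ∉ 2πℤ`. -/
theorem axis_unique_of_nontrivial {C : ℝ} {u : ℝ → E3 → E3} (hu : IsTypeIAncientMild C u)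
    (hne : ∃ t < 0, ∃ x, u t x ≠ 0) {θ : ℝ} (hθ : ∀ n : ℤ, θ ≠ n * (2 * Real.pi)) {c c' : E3}
    (hf : ∀ t < 0, ∀ x, u t (c + rotZ θ (x - c)) = rotZ θ (u t x))
    (hg : ∀ t < 0, ∀ x, u t (c' + rotZ θ (x - c')) = rotZ θ (u t x)) : c 0 = c' 0 ∧ c 1 = c' 1 := by
  by_contra h
  have h' : c 0 ≠ c' 0 ∨ c 1 ≠ c' 1 := by
    rcases not_and_or.1 h with h | h
    · exact Or.inl h
    · exact Or.inr h
  obtain ⟨t, ht, x, hx⟩ := hne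
  exact hx (row_ApaT_holds C u c c' θ hu hθ h' hf hg t ht x)

/-- Reading (centre on the axis): a NON-TRIVIAL `λ`-DSS Type-I ancient mild field with a `θ`-symmetric
vertical axis has that axis through the scaling centre. -/
theorem centre_on_axis_of_nontrivial {C : ℝ} {u : ℝ → E3 → E3} (hu : IsTypeIAncientMild C u)
    (hne : ∃ t < 0, ∃ x, u t x ≠ 0) {θ lam : ℝ} (hl : 0 < lam) (hl1 : lam ≠ 1)
    (hd : IsDiscretelySelfSimilar lam u) (hθ : ∀ n : ℤ, θ ≠ n * (2 * Real.pi)) {c : E3}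
    (hf : ∀ t < 0, ∀ x, u t (c + rotZ θ (x - c)) = rotZ θ (u t x)) : c 0 = 0 ∧ c 1 = 0 := by
  by_contra h
  have h' : c 0 ≠ 0 ∨ c 1 ≠ 0 := by
    rcases not_and_or.1 h with h | h
    · exact Or.inl h
    · exact Or.inr h
  obtain ⟨t, ht, x, hx⟩ := hne
  exact hx (row_AdsT_holds C u c θ lam hu hl hl1 hd hθ h' hf t ht x)

/-! ### §6b  Two parallel axes with DIFFERENT angles (REV 3)
Conjugating the `θ`-rotation about `c` by the `θ'`-rotation about `c'` gives the `θ`-rotation about the parallel axis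
through `ρ_{c',θ'}(c) ≠ c`; so ANY two non-trivial rotational slice-symmetries with distinct parallel vertical axes
kill the candidate (`Row_Apa2T`, via `Row_ApaT`). [folklore] -/

/-- Rotations about the same axis commute. -/
theorem rotZ_comm (a b : ℝ) (z : E3) : rotZ a (rotZ b z) = rotZ b (rotZ a z) := by
  rw [← rotZ_add, add_comm, rotZ_add]

/-- `R_{θ′} R_θ R_{−θ′} = R_θ`. -/
theorem rotZ_conj_cancel (θ θ' : ℝ) (z : E3) : rotZ θ' (rotZ θ (rotZ (-θ') z)) = rotZ θ z := by
  rw [rotZ_comm θ' θ, rotZ_rotZ_neg]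

/-- `ρ_{c',θ'} ∘ ρ_{c,θ} ∘ ρ_{c',θ'}⁻¹ = ρ_{ρ_{c',θ'}(c), θ}`. [folklore] -/
theorem vRot_conj (c c' : E3) (θ θ' : ℝ) (x : E3) :
    vRot c' θ' (vRot c θ (vRot c' (-θ') x)) = vRot (vRot c' θ' c) θ x := by
  have e1 : ∀ z : E3, rotZ θ' (rotZ θ z) = rotZ θ (rotZ θ' z) := fun z => rotZ_comm θ' θ z
  unfold vRot
  simp only [ScrewBlowdown.rotZ_add_vec, ScrewBlowdown.rotZ_sub_vec, e1, rotZ_rotZ_neg]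
  abel

/-- **Row A-pa2-T** (two parallel axes, ANY two non-trivial angles): a Type-I ancient mild field whose slices are
`θ`-equivariant about the vertical axis through `c` and `θ'`-equivariant about the DISTINCT parallel axis through
`c'` (`θ, θ' ∉ 2πℤ`) vanishes on the past. -/
def Row_Apa2T : Prop :=
  ∀ (C : ℝ) (u : ℝ → E3 → E3) (c c' : E3) (θ θ' : ℝ), IsTypeIAncientMild C u →
    (∀ n : ℤ, θ ≠ n * (2 * Real.pi)) → (∀ n : ℤ, θ' ≠ n * (2 * Real.pi)) → (c 0 ≠ c' 0 ∨ c 1 ≠ c' 1) →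
    (∀ t < 0, ∀ x, u t (c + rotZ θ (x - c)) = rotZ θ (u t x)) →
    (∀ t < 0, ∀ x, u t (c' + rotZ θ' (x - c')) = rotZ θ' (u t x)) →
    ∀ t < 0, ∀ x, u t x = 0

/-- **ROW A-pa2-T holds** (via `Row_ApaT` for the axes through `c` and `ρ_{c',θ'}(c)`). -/
theorem row_Apa2T_holds : Row_Apa2T := by
  intro C u c c' θ θ' hu hθ hθ' hcc hf hg
  set q : E3 := vRot c' θ' c with hq_def
  -- inverse equivariance about the second axis
  have hginv : ∀ t < 0, ∀ x, u t (vRot c' (-θ') x) = rotZ (-θ') (u t x) := by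
    intro t ht x
    have h1 := hg t ht (vRot c' (-θ') x)
    change u t (vRot c' θ' (vRot c' (-θ') x)) = _ at h1
    rw [vRot_vRot_neg] at h1
    rw [h1, rotZ_neg_rotZ]
  -- the conjugated symmetry: θ-rotation about the axis through q
  have hfq : ∀ t < 0, ∀ x, u t (q + rotZ θ (x - q)) = rotZ θ (u t x) := by
    intro t ht x
    have h1 : q + rotZ θ (x - q) = vRot c' θ' (vRot c θ (vRot c' (-θ') x)) := by
      rw [vRot_conj]; rfl
    rw [h1]
    change u t (c' + rotZ θ' (vRot c θ (vRot c' (-θ') x) - c')) = _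
    rw [hg t ht]
    change rotZ θ' (u t (c + rotZ θ (vRot c' (-θ') x - c))) = _
    rw [hf t ht, hginv t ht, rotZ_conj_cancel]
  -- the two axes are distinct
  have hq : c 0 ≠ q 0 ∨ c 1 ≠ q 1 := by
    have hw : (c - c') - rotZ θ' (c - c') ≠ 0 := by
      apply sub_rotZ_ne_zero (cos_ne_one_of_not_int_mul hθ')
      rcases hcc with h | h
      · left; simpa [sub_eq_zero] using h
      · right; simpa [sub_eq_zero] using h
    have hcq : c - q = (c - c') - rotZ θ' (c - c') := by
      simp only [hq_def, vRot]; abel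
    by_contra h
    rcases not_or.1 h with ⟨h0, h1⟩
    push Not at h0 h1
    apply hw
    rw [← hcq]
    ext i
    fin_cases i
    · simpa [sub_eq_zero] using h0
    · simpa [sub_eq_zero] using h1
    · simp [hcq]
  exact row_ApaT_holds C u c q θ hu hθ hq hf hfq

end Summit.NavierStokesRegularity.NavierStokesRegularity.Theorems.ScenarioCensus.RotationOrder

namespace Summit.NavierStokesRegularity.NavierStokesRegularity.Theorems.ScenarioCensus

/-! ## Census KEYS (ns `…Theorems.ScenarioCensus`): members of rows A9 / A13 decided by the rotation-order meter — TREE-decided -/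

/-- **Cell A9ir** (row A9 family; Type-I ancient mild · ONE rotation of INFINITE order about a fixed vertical axis ⇒ `u ≡ 0` on `t < 0`):
`:= RotationOrder.Row_AirT` (alias); any axis: `RotationOrder.Row_AiaT` / `row_AiaT_holds`. DECIDED. -/
def Row_A9ir : Prop := RotationOrder.Row_AirT
/-- A9ir is EXCLUDED (decided in the tree): `RotationOrder.row_AirT_holds`. -/
theorem row_A9ir_excluded : Row_A9ir := RotationOrder.row_AirT_holds

/-- **Cell A9nc** (rotation-order group about `e₃` not cyclic ⇒ `u ≡ 0`): `:= RotationOrder.Row_AncT`. DECIDED. -/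
def Row_A9nc : Prop := RotationOrder.Row_AncT
/-- A9nc is EXCLUDED (decided in the tree): `RotationOrder.row_AncT_holds`. -/
theorem row_A9nc_excluded : Row_A9nc := RotationOrder.row_AncT_holds

/-- **Cell A9sr** (one roto-reflection of infinite order ⇒ `u ≡ 0`): `:= RotationOrder.Row_AsrT`. DECIDED. -/
def Row_A9sr : Prop := RotationOrder.Row_AsrT
/-- A9sr is EXCLUDED (decided in the tree): `RotationOrder.row_AsrT_holds`. -/
theorem row_A9sr_excluded : Row_A9sr := RotationOrder.row_AsrT_holds

/-- **Cell A9pa** (θ-equivariance, `θ ∉ 2πℤ`, about two DISTINCT parallel vertical axes ⇒ `u ≡ 0`): `:= RotationOrder.Row_Apa2T` (two possibly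
different angles; the equal-angle form is `RotationOrder.Row_ApaT` / `row_ApaT_holds`). DECIDED. -/
def Row_A9pa : Prop := RotationOrder.Row_Apa2T
/-- A9pa is EXCLUDED (decided in the tree): `RotationOrder.row_Apa2T_holds`. -/
theorem row_A9pa_excluded : Row_A9pa := RotationOrder.row_Apa2T_holds

/-- **Cell AD9c** (λ-DSS about the origin, θ-symmetric vertical axis NOT through the origin ⇒ `u ≡ 0`): `:= RotationOrder.Row_AdsT`. DECIDED. -/
def Row_AD9c : Prop := RotationOrder.Row_AdsT
/-- AD9c is EXCLUDED (decided in the tree): `RotationOrder.row_AdsT_holds`. -/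
theorem row_AD9c_excluded : Row_AD9c := RotationOrder.row_AdsT_holds

/-- **Cell A13sq** (row A13 family; one discrete SCREW `R_{2πp/q} + h e₃`, `q ≥ 1`, `h ≠ 0` ⇒ `u ≡ 0`; its `q`-th power is the period
`qh e₃`, tree `PeriodicGauge.periodic_typeI_liouville_genuine`): `:= RotationOrder.Row_AsqT`. DECIDED. -/
def Row_A13sq : Prop := RotationOrder.Row_AsqT
/-- A13sq is EXCLUDED (decided in the tree): `RotationOrder.row_AsqT_holds`. -/
theorem row_A13sq_excluded : Row_A13sq := RotationOrder.row_AsqT_holds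

end Summit.NavierStokesRegularity.NavierStokesRegularity.Theorems.ScenarioCensus

end
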